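import Mathlib.NumberTheory.SumTwoSquares
import Mathlib.NumberTheory.LegendreSymbol.JacobiSymbol
import Literature.NumberTheory.Waring.LegendreThreeSquares
import HarnessLib

set_option linter.dupNamespace false -- `Summit.BirchSwinnertonDyer.BirchSwinnertonDyer.Theorems.…` (summit = sub)
set_option autoImplicit false

/-!
# Crux `HeegnerTwistCouplingInSupply` (stmt-BirchSwinnertonDyer-21381) — the THREE-SQUARES PIN (card
# `three-squares-heegner-pin`, first lemma `ThreeSquaresPin`), PROVED UNCONDITIONALLY

Route `BiquadraticEisensteinDescent` (cell `pub/bsd-wall`, row-12 line lead `bsd-line-ibd-p1` g10). Crux idea card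
`Cruxes/HeegnerTwistCouplingInSupply/Ideas/three-squares-heegner-pin.md` (crux-ideate seat 2 g14) pins, for every prime
`p ≡ 3 (mod 4)`, an auxiliary prime `ℓ < 2p` with `ℓ ≡ 5 (mod 8)` and `(ℓ/p) = −1` (type `(5,−)`) out of a Legendre–Gauss
representation `2p = x² + y² + z²`: with `z` odd, `a = 2p − z² = x² + y² ≡ 5 (mod 8)`; every prime `q ≡ 3 (mod 4)` divides
`x² + y²` to an even power, so modulo `8` the prime factorisation of `a` is a product of `1`'s, of squares of `3`'s and `7`'s,
and of primes `≡ 5 (mod 8)` — hence one prime factor `ℓ ≡ 5 (mod 8)` exists; `z² ≡ 2p (mod ℓ)` gives `(2p/ℓ) = 1`, `(2/ℓ) = −1`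
gives `(p/ℓ) = −1`, and reciprocity (`ℓ ≡ 1 (mod 4)`) gives `(ℓ/p) = −1`. The card listed the three-square theorem as an input
«not in Mathlib or the tree»; it IS in the tree (`Literature.NumberTheory.Waring.sum_three_squares_iff_mod_eight`, Serre IV
Appendix via Hasse–Minkowski + Davenport–Cassels, sorry-free), so the pin is a THEOREM: `threeSquaresPin` below has the card's
signature `ThreeSquaresPin` VERBATIM (`SketchIdeasSeat2G14.lean`). Also proved: the Heegner arithmetic of the witness field
`K′ = ℚ(√−3ℓ)` used by the card's corner targets (`−3ℓ ≡ 1 (mod 8)`, i.e. `2` splits; `(−3ℓ/p) = +1` for `p ≡ 2 (mod 3)`,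
i.e. `p` splits) and the size bound `3ℓ < 6p`. THEOREMS ONLY; nothing about the crux itself (the coupling on the tail), about
`L`-values, class numbers or any case of BSD is asserted. Supports stmt-BirchSwinnertonDyer-21381.
-/

namespace Summit.BirchSwinnertonDyer.BirchSwinnertonDyer.Theorems.BiquadraticEisensteinDescentHeegnerTwistCouplingInSupplyThreeSquaresPin

open Literature.NumberTheory.Waring

/-! ## §1 Residues modulo `8` -/

/-- The square of an odd natural number is `≡ 1 (mod 8)`. [folklore] -/
theorem sq_mod_eight_of_odd {z : ℕ} (hz : z % 2 = 1) : z ^ 2 % 8 = 1 := by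
  have h : z % 8 = 1 ∨ z % 8 = 3 ∨ z % 8 = 5 ∨ z % 8 = 7 := by omega
  rw [Nat.pow_mod]
  rcases h with h | h | h | h <;> rw [h]

/-- **Mod-`8` bookkeeping.** An odd natural number none of whose prime factors is `≡ 5 (mod 8)` and all of whose prime
factors `≡ 3 (mod 4)` occur to an even power is `≡ 1 (mod 8)`: modulo `8` its factorisation is a product of `1`'s and of
even powers of `3`, `7` (`3² ≡ 7² ≡ 1`). [folklore] -/
theorem cast_zmod_eight_eq_one {a : ℕ} (ha0 : a ≠ 0) (hodd : a % 2 = 1)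
    (h5 : ∀ q ∈ a.primeFactors, q % 8 ≠ 5)
    (h3 : ∀ q ∈ a.primeFactors, q % 4 = 3 → Even (a.factorization q)) :
    (a : ZMod 8) = 1 := by
  conv_lhs => rw [← Nat.prod_factorization_pow_eq_self ha0]
  rw [Finsupp.prod, Nat.support_factorization, Nat.cast_prod]
  refine Finset.prod_eq_one fun q hq => ?_
  rw [Nat.cast_pow]
  have hqp : q.Prime := Nat.prime_of_mem_primeFactors hq
  have hqdvd : q ∣ a := Nat.dvd_of_mem_primeFactors hq
  have hq2 : q ≠ 2 := by
    rintro rfl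
    omega
  have hqodd : q % 2 = 1 := Nat.odd_iff.mp (hqp.odd_of_ne_two hq2)
  have hcast : (q : ZMod 8) = ((q % 8 : ℕ) : ZMod 8) := (ZMod.natCast_mod q 8).symm
  have h8 : q % 8 = 1 ∨ q % 8 = 3 ∨ q % 8 = 7 := by
    have := h5 q hq
    omega
  rcases h8 with h | h | h
  · rw [hcast, h, Nat.cast_one, one_pow]
  · obtain ⟨k, hk⟩ := h3 q hq (by omega)
    rw [hcast, h, hk, ← two_mul, pow_mul]
    have h9 : ((3 : ℕ) : ZMod 8) ^ 2 = 1 := by decide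
    rw [h9, one_pow]
  · obtain ⟨k, hk⟩ := h3 q hq (by omega)
    rw [hcast, h, hk, ← two_mul, pow_mul]
    have h49 : ((7 : ℕ) : ZMod 8) ^ 2 = 1 := by decide
    rw [h49, one_pow]

/-- **A sum of two squares `≡ 5 (mod 8)` has a prime factor `≡ 5 (mod 8)`** (Fermat–Euler: primes `≡ 3 (mod 4)` divide
`x² + y²` to even powers, Mathlib `Nat.eq_sq_add_sq_iff`; then `cast_zmod_eight_eq_one`). [folklore] -/
theorem exists_prime_dvd_mod_eight_eq_five {a x y : ℕ} (hxy : x ^ 2 + y ^ 2 = a) (ha : a % 8 = 5) :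
    ∃ ℓ : ℕ, ℓ.Prime ∧ ℓ ∣ a ∧ ℓ % 8 = 5 := by
  by_contra! H
  have ha0 : a ≠ 0 := by omega
  have hsq := Nat.eq_sq_add_sq_iff.mp ⟨x, y, hxy.symm⟩
  have h1 : (a : ZMod 8) = 1 :=
    cast_zmod_eight_eq_one ha0 (by omega)
      (fun q hq => H q (Nat.prime_of_mem_primeFactors hq) (Nat.dvd_of_mem_primeFactors hq))
      (fun q hq h4 => by
        rw [Nat.factorization_def a (Nat.prime_of_mem_primeFactors hq)]
        exact hsq q hq h4)
  have h5 : (a : ZMod 8) = ((5 : ℕ) : ZMod 8) := by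
    rw [← ZMod.natCast_mod a 8, ha]
  rw [h5] at h1
  exact absurd h1 (by decide)

/-- From a representation `x² + y² + z² = n` with `n ≡ 2 (mod 4)`, one with the LAST coordinate odd (not all three are even,
permute). [folklore] -/
theorem exists_sq_add_sq_add_odd_sq {x y z n : ℕ} (h : x ^ 2 + y ^ 2 + z ^ 2 = n) (hn : n % 4 = 2) :
    ∃ a b c : ℕ, a ^ 2 + b ^ 2 + c ^ 2 = n ∧ c % 2 = 1 := by
  rcases Nat.even_or_odd z with ⟨k, rfl⟩ | hz
  · rcases Nat.even_or_odd y with ⟨m, rfl⟩ | hy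
    · rcases Nat.even_or_odd x with ⟨l, rfl⟩ | hx
      · exfalso
        have h4 : (l + l) ^ 2 + (m + m) ^ 2 + (k + k) ^ 2 = 4 * (l ^ 2 + m ^ 2 + k ^ 2) := by ring
        omega
      · exact ⟨m + m, k + k, x, by rw [← h]; ring, Nat.odd_iff.mp hx⟩
    · exact ⟨x, k + k, y, by rw [← h]; ring, Nat.odd_iff.mp hy⟩
  · exact ⟨x, y, z, h, Nat.odd_iff.mp hz⟩

/-! ## §2 The pin -/

/-- **The three-squares pin with its certificate.** For a prime `p ≡ 3 (mod 4)` there are `x y z ℓ : ℕ` with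
`x² + y² + z² = 2p`, `z` odd, `ℓ` a prime `≡ 5 (mod 8)` dividing `x² + y² = 2p − z²`; any such `ℓ` satisfies `ℓ < 2p` and
`(ℓ/p) = −1`. (Legendre–Gauss for `2p ≡ 6 (mod 8)` from the tree's `sum_three_squares_iff_mod_eight`; then §1; then
`(2p/ℓ) = 1`, `(2/ℓ) = −1`, reciprocity at `ℓ ≡ 1 (mod 4)`.) [folklore] -/
theorem exists_threeSquares_certificate {p : ℕ} (hp : p.Prime) (hp4 : p % 4 = 3) :
    ∃ x y z ℓ : ℕ, x ^ 2 + y ^ 2 + z ^ 2 = 2 * p ∧ z % 2 = 1 ∧ ℓ.Prime ∧ ℓ ∣ x ^ 2 + y ^ 2 ∧ ℓ % 8 = 5 ∧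
      ℓ < 2 * p ∧ jacobiSym (ℓ : ℤ) p = -1 := by
  have h4 : ¬ 4 ∣ 2 * p := by omega
  obtain ⟨x₀, y₀, z₀, h₀⟩ := (sum_three_squares_iff_mod_eight h4).mpr (by omega)
  obtain ⟨x, y, z, hxyz, hz⟩ := exists_sq_add_sq_add_odd_sq h₀ (by omega)
  have hz8 : z ^ 2 % 8 = 1 := sq_mod_eight_of_odd hz
  have ha5 : (x ^ 2 + y ^ 2) % 8 = 5 := by omega
  obtain ⟨ℓ, hℓ, hℓa, hℓ8⟩ := exists_prime_dvd_mod_eight_eq_five (a := x ^ 2 + y ^ 2) rfl ha5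
  have hapos : 0 < x ^ 2 + y ^ 2 := by omega
  have hℓle : ℓ ≤ x ^ 2 + y ^ 2 := Nat.le_of_dvd hapos hℓa
  have hz1 : 1 ≤ z ^ 2 := by
    have : 1 ≤ z := by omega
    exact Nat.one_le_pow 2 z this
  have hℓlt : ℓ < 2 * p := by omega
  refine ⟨x, y, z, ℓ, hxyz, hz, hℓ, hℓa, hℓ8, hℓlt, ?_⟩
  -- the symbol
  haveI : Fact p.Prime := ⟨hp⟩
  haveI : Fact ℓ.Prime := ⟨hℓ⟩
  have hp2 : p ≠ 2 := by
    rintro rfl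
    omega
  have hℓ2 : ℓ ≠ 2 := by
    rintro rfl
    omega
  have hℓp : ℓ ≠ p := by
    rintro rfl
    omega
  -- `(2p : ZMod ℓ)` is a non-zero square: `z² ≡ 2p (mod ℓ)`
  have hcast : ((x ^ 2 + y ^ 2 + z ^ 2 : ℕ) : ZMod ℓ) = ((2 * p : ℕ) : ZMod ℓ) := by rw [hxyz]
  have hzero : ((x ^ 2 + y ^ 2 : ℕ) : ZMod ℓ) = 0 := (ZMod.natCast_eq_zero_iff _ _).mpr hℓa
  push_cast at hcast hzero
  have hsq : IsSquare (((2 : ℤ) * (p : ℤ) : ℤ) : ZMod ℓ) := by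
    refine ⟨(z : ZMod ℓ), ?_⟩
    push_cast
    linear_combination -hcast + hzero
  have hne : (((2 : ℤ) * (p : ℤ) : ℤ) : ZMod ℓ) ≠ 0 := by
    have hndvd : ¬ ℓ ∣ 2 * p := by
      intro h
      rcases (Nat.Prime.dvd_mul hℓ).mp h with h | h
      · exact hℓ2 ((Nat.prime_dvd_prime_iff_eq hℓ Nat.prime_two).mp h)
      · exact hℓp ((Nat.prime_dvd_prime_iff_eq hℓ hp).mp h)
    intro h
    apply hndvd
    apply (ZMod.natCast_eq_zero_iff (2 * p) ℓ).mp
    push_cast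
    exact_mod_cast h
  have h1 : legendreSym ℓ ((2 : ℤ) * (p : ℤ)) = 1 := (legendreSym.eq_one_iff ℓ hne).mpr hsq
  rw [legendreSym.mul, legendreSym.at_two hℓ2, ZMod.χ₈_nat_eq_if_mod_eight, if_neg (by omega),
    if_neg (by omega)] at h1
  have h2 : legendreSym ℓ p = -1 := by linarith
  rw [← jacobiSym.legendreSym.to_jacobiSym p,
    legendreSym.quadratic_reciprocity_one_mod_four (p := ℓ) (q := p) (by omega) hp2, h2]

/-- **`ThreeSquaresPin` (card `three-squares-heegner-pin`, first lemma; signature VERBATIM from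
`Cruxes/HeegnerTwistCouplingInSupply/SketchIdeasSeat2G14.lean`), PROVED.** For every prime `p ≡ 3 (mod 4)` there is a
prime `ℓ < 2p` with `ℓ ≡ 5 (mod 8)` and `(ℓ/p) = −1` — a Siegel-free, explicit small prime in a Chebotarev class of
density `1/4`, read off a represented integer `2p − z²` instead of being counted. [folklore] -/
theorem threeSquaresPin : ∀ p : ℕ, p.Prime → p % 4 = 3 →
    ∃ ℓ : ℕ, ℓ.Prime ∧ ℓ < 2 * p ∧ ℓ % 8 = 5 ∧ jacobiSym (ℓ : ℤ) p = -1 := by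
  intro p hp hp4
  obtain ⟨-, -, -, ℓ, -, -, hℓ, -, hℓ8, hℓlt, hJ⟩ := exists_threeSquares_certificate hp hp4
  exact ⟨ℓ, hℓ, hℓlt, hℓ8, hJ⟩

/-! ## §3 Heegner arithmetic of the witness field `K′ = ℚ(√−3ℓ)` -/

/-- `2` splits in `ℚ(√−3ℓ)`: for `ℓ ≡ 5 (mod 8)`, `−3ℓ ≡ 1 (mod 8)`. [folklore] -/
theorem neg_three_mul_emod_eight {ℓ : ℕ} (hℓ8 : ℓ % 8 = 5) : (-(3 * (ℓ : ℤ))) % 8 = 1 := by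
  omega

/-- `(−3/p) = −1` (Jacobi symbol) for `p ≡ 3 (mod 4)` with `p ≡ 2 (mod 3)` (no primality needed):
`(−1/p) = −1`, `(3/p) = −(p/3) = −(2/3) = +1`. [folklore] -/
theorem jacobiSym_neg_three {p : ℕ} (hp4 : p % 4 = 3) (hp3 : p % 3 = 2) :
    jacobiSym (-3) p = -1 := by
  have hpodd : Odd p := Nat.odd_iff.mpr (by omega)
  have h3 : jacobiSym 3 p = 1 := by
    have hrec := jacobiSym.quadratic_reciprocity_three_mod_four (a := 3) (b := p) (by norm_num) hp4
    -- `J(3 | p) = -J(p | 3)` and `J(p | 3) = J(2 | 3) = -1`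
    have hp3' : jacobiSym (p : ℤ) 3 = -1 := by
      rw [jacobiSym.mod_left (p : ℤ) 3]
      have h23 : (p : ℤ) % ((3 : ℕ) : ℤ) = 2 := by
        push_cast
        omega
      rw [h23, jacobiSym.at_two (by decide : Odd 3), ZMod.χ₈_nat_eq_if_mod_eight]
      decide
    have : ((3 : ℕ) : ℤ) = 3 := by norm_num
    rw [this] at hrec
    rw [hrec, hp3', neg_neg]
  have hm1 : jacobiSym (-1) p = -1 := by
    rw [jacobiSym.at_neg_one hpodd, ZMod.χ₄_nat_eq_if_mod_four, if_neg (by omega), if_neg (by omega)]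
  have : (-3 : ℤ) = (-1) * 3 := by norm_num
  rw [this, jacobiSym.mul_left, hm1, h3]
  norm_num

/-- `p` splits in `ℚ(√−3ℓ)`: `(−3ℓ/p) = (−3/p)(ℓ/p) = (−1)(−1) = +1` for `p ≡ 3 (mod 4)`, `p ≡ 2 (mod 3)` and any `ℓ`
with `(ℓ/p) = −1` (the pinned one). [folklore] -/
theorem jacobiSym_neg_three_mul {p ℓ : ℕ} (hp4 : p % 4 = 3) (hp3 : p % 3 = 2)
    (hJ : jacobiSym (ℓ : ℤ) p = -1) : jacobiSym (-(3 * (ℓ : ℤ))) p = 1 := by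
  have : (-(3 * (ℓ : ℤ))) = (-3) * (ℓ : ℤ) := by ring
  rw [this, jacobiSym.mul_left, jacobiSym_neg_three hp4 hp3, hJ]
  norm_num

/-- **The pin with the Heegner data of `K′ = ℚ(√−3ℓ)` for `p ≡ 11 (mod 12)`** (the card's corners `E_{2p}`, `p ≡ 11
(mod 12)`, and `E_p`, `p ≡ 23 (mod 24)`): a prime `ℓ < 2p`, `ℓ ≡ 5 (mod 8)`, `(ℓ/p) = −1`, with `d = −3ℓ ≡ 1 (mod 8)`
(`2` split), `(d/p) = +1` (`p` split) and `|d| = 3ℓ < 6p` (the size lever's input). Nothing about `L`-values or class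
numbers is asserted. [folklore] -/
theorem exists_pin_heegnerData {p : ℕ} (hp : p.Prime) (hp12 : p % 12 = 11) :
    ∃ ℓ : ℕ, ℓ.Prime ∧ ℓ < 2 * p ∧ ℓ % 8 = 5 ∧ jacobiSym (ℓ : ℤ) p = -1 ∧
      (-(3 * (ℓ : ℤ))) % 8 = 1 ∧ jacobiSym (-(3 * (ℓ : ℤ))) p = 1 ∧ 3 * ℓ < 6 * p := by
  obtain ⟨ℓ, hℓ, hℓlt, hℓ8, hJ⟩ := threeSquaresPin p hp (by omega)
  exact ⟨ℓ, hℓ, hℓlt, hℓ8, hJ, neg_three_mul_emod_eight hℓ8, jacobiSym_neg_three_mul (by omega) (by omega) hJ,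
    by omega⟩

end Summit.BirchSwinnertonDyer.BirchSwinnertonDyer.Theorems.BiquadraticEisensteinDescentHeegnerTwistCouplingInSupplyThreeSquaresPin
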